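import Literature.AnabelianGeometry.AbsoluteAnabelian.AbsAnabUnitsTransportProofs
import Literature.AnabelianGeometry.AbsoluteAnabelian.AbsAnabLevelCompatProofs
import Literature.AnabelianGeometry.AbsoluteAnabelian.AbsAnabUnitsTransportUnique
import HarnessLib

/-!
# [AbsAnab] Prop 1.2.1 (vi)/(vii): the units transport `ψ̄ : K̄₁^× ⥲ K̄₂^×` RESTRICTS to the level
# isomorphisms `Art_{L₂}⁻¹ ∘ α^{ab} ∘ Art_{L₁}` (the level clause of row L02, exported)

S. Mochizuki, *The Absolute Anabelian Geometry of Hyperbolic Curves* (2004) [AbsAnab], Prop. 1.2.1 (vi)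
p. 10 / proof p. 11: the identification of multiplicative groups is, at every finite Galois level
`G_{L₁} = U`, `α(U) = G_{L₂}`, the map `Art_{L₂}⁻¹ ∘ (α|_U)^{ab} ∘ Art_{L₁}` ("group-theoretic, by (iii)"),
the levels being compatible "by considering the Verlagerung".  The abc-iut typing records the colimit as
row L02 `Prop121vii.UnitsTransport` (abc-iut-w5-d198) = the EXISTENCE of an `α`-equivariant
`ψ̄ : K̄₁^× ⥲ K̄₂^×` with units/uniformiser clauses, PROVED by abc-iut-L4-d3
(`AbsAnabUnitsTransportProofs` + `AbsAnabLevelCompatProofs` + `AbsAnabUnitsTransportHolds`, p418393), and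
UNIQUE (abc-iut-L6-t13, `unitsTransport_unique`, p417701).  The gluing proof of abc-iut-L4-d3 KNOWS that the
glued `ψ̄` restricts to the level isomorphisms `ψ_L` of `exists_levelIso` — but its exported statement
forgets it.  Consumers that compare `ψ̄` with local class field theory at finite levels (the naturality of
the cyclotome identification `μ_{ℚ/ℤ}(G_k) ≅ μ(k̄)` under arbitrary topological automorphisms of `G_k`,
[AbsTopIII] Rmk. 3.2.1 — abc-iut-L6-t11's `GaloisCyclotomeTransportNaturality`) need exactly this
LEVEL CLAUSE.  THIS PROOF-ONLY FILE (abc-iut-L6-t11; nothing of abc-iut-L4-d3 is edited) re-runs that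
gluing VERBATIM with the hypothesis `hcompat` discharged by `levelIso_compat` (as in
`unitsTransport_holds`) and ONE more conjunct in the conclusion:

* `Prop121vii.exists_unitsTransport_level` — `ψ̄` as in row L02, AND: for every finite Galois `L ⊆ K̄₁`
  there is a finite Galois partner `M ⊆ K̄₂` with `α(Gal(K̄₁/L)) = Gal(K̄₂/M)` such that for EVERY pair of
  reciprocity maps `Art₁, Art₂` characterised by Serre's `θ` (the clauses of `exists_levelIso`;
  unique by `levelArt_unique`) and every `u ∈ (ι⁻¹L)ˣ` with `Art₁ u = [h]`, the value `ψ̄ u` lies in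
  `(ι⁻¹M)ˣ` and `Art₂ (ψ̄ u) = [α h]`;
* `Prop121vii.unitsTransport_level` — by uniqueness, EVERY `α`-equivariant uniformiser-preserving
  `ψ̄ : K̄₁^× ⥲ K̄₂^×` has this level clause.

Classical local class field theory (Serre XIII–XIV; Neukirch IV (5.8)–(5.9), (6.3)); theorems only, no
definitions, no named facts; universe `0` (that of `exists_levelIso`).  HONEST FRAMING: nothing here bears
on [IUTchIII] Cor. 3.12, and nothing asserts that abc is proved or refuted.
-/

noncomputable section

open Field IsNonarchimedeanLocalField ValuativeRel
open scoped Pointwise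

namespace Literature.AnabelianGeometry.AbsoluteAnabelian

open Literature.NumberTheory.GaloisRepresentations
open Literature.NumberTheory.GaloisRepresentations.IsNonarchimedeanLocalField
open Literature.NumberTheory.GaloisRepresentations.LocalWeilDatum
open AbstractCFT AbstractCFT.WeilDatum

namespace Prop121vii

variable {K₁ K₂ : Type} [Field K₁] [ValuativeRel K₁] [TopologicalSpace K₁]
  [IsNonarchimedeanLocalField K₁] [CharZero K₁] [Field K₂] [ValuativeRel K₂] [TopologicalSpace K₂]
  [IsNonarchimedeanLocalField K₂] [CharZero K₂]

-- abc-iut-L4-d3's gluing is ONE declaration (the index set, partners, level isomorphisms and the glued map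
-- share `choose`-data); re-run with the extra conjunct and `levelIso_compat` inlined it exceeds the default
-- budget of a single declaration.
set_option maxHeartbeats 400000 in
/-- **Row L02 `UnitsTransport` WITH ITS LEVEL CLAUSE** ([AbsAnab] Prop. 1.2.1 (vi) p. 10; proof p. 11
"group-theoretic, by (iii)" + "by considering the Verlagerung"): for an isomorphism of profinite groups
`α : G_{K₁} ≅ G_{K₂}` there is `ψ̄ : K̄₁ˣ ⥲ K̄₂ˣ`, `α`-equivariant, carrying `𝒪_{K̄₁}^×` onto `𝒪_{K̄₂}^×` and
uniformisers of `K₁` to uniformisers of `K₂` (abc-iut-L4-d3's colimit, re-run verbatim), which moreover at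
every finite Galois level `L ⊆ K̄₁` with partner `M ⊆ K̄₂` (`α(Gal(K̄₁/L)) = Gal(K̄₂/M)`) RESTRICTS to
`(ι⁻¹L)ˣ → (ι⁻¹M)ˣ` and intertwines every pair of reciprocity maps characterised by Serre's `θ`:
`Art₁ u = [h] ⟹ Art₂ (ψ̄ u) = [α h]`. [cite: MochizukiAbsAnab2004, Prop 1.2.1 (vi) p.10] -/
theorem exists_unitsTransport_level (α : absoluteGaloisGroup K₁ ≃ₜ* absoluteGaloisGroup K₂) :
    ∃ ψ : (AlgebraicClosure K₁)ˣ ≃* (AlgebraicClosure K₂)ˣ,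
      IsAlphaEquivariant α ψ ∧ PreservesAbsUnits ψ ∧ PreservesUniformizers ψ ∧
      ∀ (L : IntermediateField K₁ (AlgebraicClosure K₁)) [FiniteDimensional K₁ L] [IsGalois K₁ L],
        ∃ (M : IntermediateField K₂ (AlgebraicClosure K₂)) (_ : FiniteDimensional K₂ M) (_ : IsGalois K₂ M)
          (hN : ∀ g : absoluteGaloisGroup K₁,
            g ∈ galFixing K₁ (embField K₁ L) ↔ α g ∈ galFixing K₂ (embField K₂ M)),
          ∀ {Art₁ : (embField K₁ L)ˣ →* TopologicalAbelianization (galFixing K₁ (embField K₁ L))}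
            {Art₂ : (embField K₂ M)ˣ →* TopologicalAbelianization (galFixing K₂ (embField K₂ M))},
            (∀ (u : (embField K₁ L)ˣ) (h : galFixing K₁ (embField K₁ L)),
              Art₁ u = QuotientGroup.mk h ↔
                ∀ (L' : IntermediateField L (AlgebraicClosure L)) [FiniteDimensional L L']
                    [IsAbelianGalois L L'],
                  AlgEquiv.restrictNormalHom L' (absoluteGaloisGroup.toAlgEquiv L (liftGal K₁ L h.2)) =
                    recSystemE (isClassFieldTheory_localWeilDatum K₁) L'
                      (Units.map ((equivEmbField K₁ L).symm : embField K₁ L →* L) u)) →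
            (∀ (u : (embField K₂ M)ˣ) (h : galFixing K₂ (embField K₂ M)),
              Art₂ u = QuotientGroup.mk h ↔
                ∀ (L' : IntermediateField M (AlgebraicClosure M)) [FiniteDimensional M L']
                    [IsAbelianGalois M L'],
                  AlgEquiv.restrictNormalHom L' (absoluteGaloisGroup.toAlgEquiv M (liftGal K₂ M h.2)) =
                    recSystemE (isClassFieldTheory_localWeilDatum K₂) L'
                      (Units.map ((equivEmbField K₂ M).symm : embField K₂ M →* M) u)) →
            ∀ (u : (embField K₁ L)ˣ) (h : galFixing K₁ (embField K₁ L)) (x : (AlgebraicClosure K₁)ˣ),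
              (x : AlgebraicClosure K₁) = ((u : embField K₁ L) : AlgebraicClosure K₁) →
              Art₁ u = QuotientGroup.mk h →
              ∃ w : (embField K₂ M)ˣ,
                ((w : embField K₂ M) : AlgebraicClosure K₂) = (ψ x : AlgebraicClosure K₂) ∧
                  Art₂ w = QuotientGroup.mk (⟨α h, (hN h).mp h.2⟩ : galFixing K₂ (embField K₂ M)) := by
  classical
  /- ### The index set: finite Galois subextensions `L ⊆ K̄₁`, their partners `M ⊆ K̄₂` -/
  let S := {L : IntermediateField K₁ (AlgebraicClosure K₁) // FiniteDimensional K₁ L ∧ IsGalois K₁ L}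
  have hP : ∀ s : S, ∃ M : IntermediateField K₂ (AlgebraicClosure K₂),
      FiniteDimensional K₂ M ∧ IsGalois K₂ M ∧
        ∀ g : absoluteGaloisGroup K₁, g ∈ galFixing K₁ s.1 ↔ α g ∈ galFixing K₂ M := fun s => by
    haveI := s.2.1
    haveI := s.2.2
    exact exists_partner_level α s.1
  choose P hPfd hPgal hPN using hP
  -- instances on the levels
  haveI iF : ∀ s : S, FiniteDimensional K₁ (s.1 : IntermediateField K₁ (AlgebraicClosure K₁)) :=
    fun s => s.2.1
  haveI iG : ∀ s : S, IsGalois K₁ (s.1 : IntermediateField K₁ (AlgebraicClosure K₁)) := fun s => s.2.2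
  haveI iF₂ : ∀ s : S, FiniteDimensional K₂ (P s) := fun s => hPfd s
  haveI iG₂ : ∀ s : S, IsGalois K₂ (P s) := fun s => hPgal s
  haveI : CharZero (AlgebraicClosure K₁) :=
    charZero_of_injective_algebraMap (algebraMap K₁ (AlgebraicClosure K₁)).injective
  haveI : CharZero (AlgebraicClosure K₂) :=
    charZero_of_injective_algebraMap (algebraMap K₂ (AlgebraicClosure K₂)).injective
  letI iV : ∀ s : S, ValuativeRel (s.1 : IntermediateField K₁ (AlgebraicClosure K₁)) :=
    fun s => FiniteExtension.valuativeRel K₁ _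
  letI iT : ∀ s : S, TopologicalSpace (s.1 : IntermediateField K₁ (AlgebraicClosure K₁)) :=
    fun s => FiniteExtension.topologicalSpace K₁ _
  haveI iL : ∀ s : S, IsNonarchimedeanLocalField (s.1 : IntermediateField K₁ (AlgebraicClosure K₁)) :=
    fun s => FiniteExtension.isNonarchimedeanLocalField K₁ _
  haveI iX : ∀ s : S, ValuativeExtension K₁ (s.1 : IntermediateField K₁ (AlgebraicClosure K₁)) :=
    fun s => FiniteExtension.valuativeExtension K₁ _
  letI iV₂ : ∀ s : S, ValuativeRel (P s) := fun s => FiniteExtension.valuativeRel K₂ _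
  letI iT₂ : ∀ s : S, TopologicalSpace (P s) := fun s => FiniteExtension.topologicalSpace K₂ _
  haveI iL₂ : ∀ s : S, IsNonarchimedeanLocalField (P s) :=
    fun s => FiniteExtension.isNonarchimedeanLocalField K₂ _
  haveI iX₂ : ∀ s : S, ValuativeExtension K₂ (P s) := fun s => FiniteExtension.valuativeExtension K₂ _
  -- bottom level `E = K`
  haveI : ValuativeExtension K₁ K₁ := ⟨fun _ _ => Iff.rfl⟩
  haveI : ValuativeExtension K₂ K₂ := ⟨fun _ _ => Iff.rfl⟩
  -- the subgroup correspondence at each level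
  have hNs : ∀ (s : S) (g : absoluteGaloisGroup K₁),
      g ∈ galFixing K₁ (embField K₁ (s.1 : IntermediateField K₁ (AlgebraicClosure K₁))) ↔
        α g ∈ galFixing K₂ (embField K₂ (P s)) := fun s g => by
    rw [mem_galFixing_embField_coe_iff, mem_galFixing_embField_coe_iff]
    exact hPN s g
  have hN₀ : ∀ g : absoluteGaloisGroup K₁,
      g ∈ galFixing K₁ (embField K₁ K₁) ↔ α g ∈ galFixing K₂ (embField K₂ K₂) := fun g =>
    ⟨fun _ => mem_galFixing_embField_self _, fun _ => mem_galFixing_embField_self _⟩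
  /- ### The level isomorphisms (gen 3: `exists_levelIso`) -/
  have hlev := fun s : S => exists_levelIso α (hNs s)
  choose ψ hψ₁ hψ₂ hψ₃ hψ₄ using hlev
  obtain ⟨ψ₀, hψ₀₁, -, -, hψ₀₄⟩ := exists_levelIso α hN₀
  /- ### Galois correspondence bookkeeping -/
  -- partners are monotone
  have hPmono : ∀ s t : S, s.1 ≤ t.1 → P s ≤ P t := by
    intro s t hst
    apply le_of_galFixing_le
    intro g' hg'
    have h1 : α.symm g' ∈ galFixing K₁ t.1 := by
      rw [hPN t, α.apply_symm_apply]; exact hg'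
    have h2 : α.symm g' ∈ galFixing K₁ s.1 := galFixing_antitone K₁ hst h1
    rw [hPN s, α.apply_symm_apply] at h2
    exact h2
  -- levels cover pairs
  have hcov : ∀ x y : AlgebraicClosure K₁, ∃ s : S,
      x ∈ embField K₁ (s.1 : IntermediateField K₁ (AlgebraicClosure K₁)) ∧
        y ∈ embField K₁ (s.1 : IntermediateField K₁ (AlgebraicClosure K₁)) := by
    intro x y
    obtain ⟨Lx, hLx₁, hLx₂, hx⟩ := exists_level_mem (K := K₁) x
    obtain ⟨Ly, hLy₁, hLy₂, hy⟩ := exists_level_mem (K := K₁) y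
    obtain ⟨L, hL₁, hL₂, hxL, hyL⟩ := exists_level_ge Lx Ly
    haveI := hL₂
    refine ⟨⟨L, hL₁, hL₂⟩, ?_, ?_⟩
    · exact (mem_embField_coe_iff L).mpr (hxL hx)
    · exact (mem_embField_coe_iff L).mpr (hyL hy)
  have hcov₁ : ∀ x : AlgebraicClosure K₁, ∃ s : S,
      x ∈ embField K₁ (s.1 : IntermediateField K₁ (AlgebraicClosure K₁)) := fun x =>
    (hcov x x).imp fun _ h => h.1
  -- partners cover `K̄₂`
  have hcovM : ∀ y : AlgebraicClosure K₂, ∃ s : S, y ∈ embField K₂ (P s) := by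
    intro y
    obtain ⟨M', hM'₁, hM'₂, hy⟩ := exists_level_mem (K := K₂) y
    haveI := hM'₁
    haveI := hM'₂
    obtain ⟨L', hL'₁, hL'₂, hL'N⟩ := exists_partner_level α.symm M'
    let s : S := ⟨L', hL'₁, hL'₂⟩
    have hPs : P s = M' := by
      apply le_antisymm
      · apply le_of_galFixing_le
        intro g' hg'
        have h1 : α.symm g' ∈ galFixing K₁ L' := (hL'N g').mp hg'
        have h2 := (hPN s (α.symm g')).mp h1
        rwa [α.apply_symm_apply] at h2
      · apply le_of_galFixing_le
        intro g' hg'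
        have h1 : α.symm g' ∈ galFixing K₁ L' := by
          rw [hPN s, α.apply_symm_apply]; exact hg'
        exact (hL'N g').mpr h1
    refine ⟨s, (mem_embField_coe_iff (P s)).mpr ?_⟩
    rw [hPs]
    exact hy
  -- compatibility of the level isomorphisms (the Verlagerung step, hypothesis `hcompat`)
  have hcompat' : ∀ (s t : S) (u : (embField K₁ (s.1 : IntermediateField K₁ (AlgebraicClosure K₁)))ˣ)
      (w : (embField K₁ (t.1 : IntermediateField K₁ (AlgebraicClosure K₁)))ˣ),
      ((u : embField K₁ (s.1 : IntermediateField K₁ (AlgebraicClosure K₁))) : AlgebraicClosure K₁) =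
        ((w : embField K₁ (t.1 : IntermediateField K₁ (AlgebraicClosure K₁))) : AlgebraicClosure K₁) →
      ((ψ s u : embField K₂ (P s)) : AlgebraicClosure K₂) =
        ((ψ t w : embField K₂ (P t)) : AlgebraicClosure K₂) := by
    intro s t u w huw
    obtain ⟨L, hL₁, hL₂, hsL, htL⟩ := exists_level_ge
      (s.1 : IntermediateField K₁ (AlgebraicClosure K₁)) (t.1 : IntermediateField K₁ (AlgebraicClosure K₁))
    let r : S := ⟨L, hL₁, hL₂⟩
    have hsr : embField K₁ (s.1 : IntermediateField K₁ (AlgebraicClosure K₁)) ≤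
        embField K₁ (r.1 : IntermediateField K₁ (AlgebraicClosure K₁)) := embField_coe_le_of_le hsL
    have htr : embField K₁ (t.1 : IntermediateField K₁ (AlgebraicClosure K₁)) ≤
        embField K₁ (r.1 : IntermediateField K₁ (AlgebraicClosure K₁)) := embField_coe_le_of_le htL
    have hsr₂ : embField K₂ (P s) ≤ embField K₂ (P r) := embField_coe_le_of_le (hPmono s r hsL)
    have htr₂ : embField K₂ (P t) ≤ embField K₂ (P r) := embField_coe_le_of_le (hPmono t r htL)
    have e₁ := levelIso_compat α _ _ _ _ (hNs s) (hNs r) hsr hsr₂ (ψ s) (ψ r) (hψ₁ s) (hψ₁ r) u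
    have e₂ := levelIso_compat α _ _ _ _ (hNs t) (hNs r) htr htr₂ (ψ t) (ψ r) (hψ₁ t) (hψ₁ r) w
    have hmap : Units.map (IntermediateField.inclusion hsr :
          embField K₁ (s.1 : IntermediateField K₁ (AlgebraicClosure K₁)) →*
            embField K₁ (r.1 : IntermediateField K₁ (AlgebraicClosure K₁))) u =
        Units.map (IntermediateField.inclusion htr :
          embField K₁ (t.1 : IntermediateField K₁ (AlgebraicClosure K₁)) →*
            embField K₁ (r.1 : IntermediateField K₁ (AlgebraicClosure K₁))) w := by
      apply Units.ext
      apply Subtype.ext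
      exact huw
    rw [← e₁, ← e₂, hmap]
  /- ### Glue -/
  obtain ⟨Ψ, hΨ⟩ := exists_mulEquiv_units_restricting
    (fun s : S => embField K₁ (s.1 : IntermediateField K₁ (AlgebraicClosure K₁)))
    (fun s : S => embField K₂ (P s)) ψ hcov hcovM hcompat'
  refine ⟨Ψ, ?_, ?_, ?_, ?_⟩
  /- ### (a) `α`-equivariance, from level clause (2) -/
  · intro σ x
    apply Units.ext
    rw [Units.coe_smul]
    exact glued_rel_of_level_rel hcov hΨ (f₁ := fun a => σ • a) (f₂ := fun b => α σ • b)
      (fun s u u' h => hψ₂ s σ u u' h) x (σ • x) (Units.coe_smul σ x)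
  /- ### (b) units onto units, from level clause (3) -/
  · intro x
    have key := glued_iff_of_level_iff hcov₁ hΨ
      (P₁ := fun a : AlgebraicClosure K₁ => a ∈ absIntegers 𝒪[K₁] K₁ ∧ a⁻¹ ∈ absIntegers 𝒪[K₁] K₁)
      (P₂ := fun b : AlgebraicClosure K₂ => b ∈ absIntegers 𝒪[K₂] K₂ ∧ b⁻¹ ∈ absIntegers 𝒪[K₂] K₂)
      (fun s u => by
        have h₁ := coe_mem_absIntegers_iff_map_mem_unitGroup K₁
          (s.1 : IntermediateField K₁ (AlgebraicClosure K₁)) u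
        have h₂ := coe_mem_absIntegers_iff_map_mem_unitGroup K₂ (P s) (ψ s u)
        rw [Units.val_inv_eq_inv_val, IntermediateField.coe_inv] at h₁ h₂
        exact (h₁.trans (hψ₃ s u)).trans h₂.symm) x
    rw [Units.val_inv_eq_inv_val, Units.val_inv_eq_inv_val]
    exact key
  /- ### (c) uniformisers to uniformisers, from level clause (4) at the bottom level -/
  · intro π₁ hπ₁
    let u₀ : (embField K₁ K₁)ˣ := Units.map (equivEmbField K₁ K₁ : K₁ →* embField K₁ K₁) π₁
    have hu₀ : Units.map ((equivEmbField K₁ K₁).symm : embField K₁ K₁ →* K₁) u₀ = π₁ := by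
      apply Units.ext
      change (equivEmbField K₁ K₁).symm (equivEmbField K₁ K₁ (π₁ : K₁)) = π₁
      exact (equivEmbField K₁ K₁).symm_apply_apply _
    let π₂ : K₂ˣ := Units.map ((equivEmbField K₂ K₂).symm : embField K₂ K₂ →* K₂) (ψ₀ u₀)
    have hπ₂ : (valuation K₂).IsUniformizer (π₂ : K₂) := by
      have h := hψ₀₄ u₀
      rw [hu₀] at h
      exact h hπ₁
    refine ⟨π₂, hπ₂, Units.ext ?_⟩
    -- evaluate `Ψ` at `π₁` through a level containing it and the compatibility with the bottom level
    let x : (AlgebraicClosure K₁)ˣ :=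
      Units.map (algebraMap K₁ (AlgebraicClosure K₁) : K₁ →* AlgebraicClosure K₁) π₁
    have hxu₀ : (x : AlgebraicClosure K₁) = ((u₀ : embField K₁ K₁) : AlgebraicClosure K₁) := by
      rw [coe_embField_self]
      change algebraMap K₁ (AlgebraicClosure K₁) (π₁ : K₁) =
        algebraMap K₁ (AlgebraicClosure K₁) ((equivEmbField K₁ K₁).symm (equivEmbField K₁ K₁ (π₁ : K₁)))
      rw [(equivEmbField K₁ K₁).symm_apply_apply]
    obtain ⟨s, hs⟩ := hcov₁ (x : AlgebraicClosure K₁)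
    have hle₁ : embField K₁ K₁ ≤ embField K₁ (s.1 : IntermediateField K₁ (AlgebraicClosure K₁)) :=
      embField_self_le _
    have hle₂ : embField K₂ K₂ ≤ embField K₂ (P s) := embField_self_le _
    let u : (embField K₁ (s.1 : IntermediateField K₁ (AlgebraicClosure K₁)))ˣ :=
      Units.map (IntermediateField.inclusion hle₁ :
        embField K₁ K₁ →* embField K₁ (s.1 : IntermediateField K₁ (AlgebraicClosure K₁))) u₀
    have hxu : (x : AlgebraicClosure K₁) =
        ((u : embField K₁ (s.1 : IntermediateField K₁ (AlgebraicClosure K₁))) : AlgebraicClosure K₁) :=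
      hxu₀
    have e := levelIso_compat α _ _ _ _ hN₀ (hNs s) hle₁ hle₂ ψ₀ (ψ s) hψ₀₁ (hψ₁ s) u₀
    change (Ψ x : AlgebraicClosure K₂) = algebraMap K₂ (AlgebraicClosure K₂) (π₂ : K₂)
    rw [hΨ s u x hxu, e, coe_embField_self]
    rfl

  /- ### (d) the LEVEL CLAUSE: `Ψ` restricts to the level isomorphisms, which intertwine the reciprocity maps -/
  · intro L hLfin hLgal
    let s : S := ⟨L, hLfin, hLgal⟩
    refine ⟨P s, hPfd s, hPgal s, hNs s, ?_⟩
    intro Art₁ Art₂ hchar₁ hchar₂ u h x hx hArt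
    exact ⟨ψ s u, (hΨ s u x hx).symm, hψ₁ s hchar₁ hchar₂ u h hArt⟩

/-- **Every units transport has the level clause**: an `α`-equivariant `ψ̄ : K̄₁ˣ ⥲ K̄₂ˣ` carrying
uniformisers of `K₁` to uniformisers of `K₂` coincides with the glued one (`unitsTransport_unique`,
abc-iut-L6-t13), hence restricts at every finite Galois level to the level isomorphism intertwining the
characterised reciprocity maps: `Art₁ u = [h] ⟹ ψ̄ u ∈ (ι⁻¹M)ˣ ∧ Art₂ (ψ̄ u) = [α h]` ([AbsAnab] proof of
Prop. 1.2.1 p. 11, «THE morphism induced by `α`»). [cite: MochizukiAbsAnab2004, Prop 1.2.1 (vii) p.11] -/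
theorem unitsTransport_level {α : absoluteGaloisGroup K₁ ≃ₜ* absoluteGaloisGroup K₂}
    {ψ : (AlgebraicClosure K₁)ˣ ≃* (AlgebraicClosure K₂)ˣ} (hψ : IsAlphaEquivariant α ψ)
    (hU : PreservesUniformizers ψ) :
      ∀ (L : IntermediateField K₁ (AlgebraicClosure K₁)) [FiniteDimensional K₁ L] [IsGalois K₁ L],
        ∃ (M : IntermediateField K₂ (AlgebraicClosure K₂)) (_ : FiniteDimensional K₂ M) (_ : IsGalois K₂ M)
          (hN : ∀ g : absoluteGaloisGroup K₁,
            g ∈ galFixing K₁ (embField K₁ L) ↔ α g ∈ galFixing K₂ (embField K₂ M)),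
          ∀ {Art₁ : (embField K₁ L)ˣ →* TopologicalAbelianization (galFixing K₁ (embField K₁ L))}
            {Art₂ : (embField K₂ M)ˣ →* TopologicalAbelianization (galFixing K₂ (embField K₂ M))},
            (∀ (u : (embField K₁ L)ˣ) (h : galFixing K₁ (embField K₁ L)),
              Art₁ u = QuotientGroup.mk h ↔
                ∀ (L' : IntermediateField L (AlgebraicClosure L)) [FiniteDimensional L L']
                    [IsAbelianGalois L L'],
                  AlgEquiv.restrictNormalHom L' (absoluteGaloisGroup.toAlgEquiv L (liftGal K₁ L h.2)) =
                    recSystemE (isClassFieldTheory_localWeilDatum K₁) L'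
                      (Units.map ((equivEmbField K₁ L).symm : embField K₁ L →* L) u)) →
            (∀ (u : (embField K₂ M)ˣ) (h : galFixing K₂ (embField K₂ M)),
              Art₂ u = QuotientGroup.mk h ↔
                ∀ (L' : IntermediateField M (AlgebraicClosure M)) [FiniteDimensional M L']
                    [IsAbelianGalois M L'],
                  AlgEquiv.restrictNormalHom L' (absoluteGaloisGroup.toAlgEquiv M (liftGal K₂ M h.2)) =
                    recSystemE (isClassFieldTheory_localWeilDatum K₂) L'
                      (Units.map ((equivEmbField K₂ M).symm : embField K₂ M →* M) u)) →
            ∀ (u : (embField K₁ L)ˣ) (h : galFixing K₁ (embField K₁ L)) (x : (AlgebraicClosure K₁)ˣ),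
              (x : AlgebraicClosure K₁) = ((u : embField K₁ L) : AlgebraicClosure K₁) →
              Art₁ u = QuotientGroup.mk h →
              ∃ w : (embField K₂ M)ˣ,
                ((w : embField K₂ M) : AlgebraicClosure K₂) = (ψ x : AlgebraicClosure K₂) ∧
                  Art₂ w = QuotientGroup.mk (⟨α h, (hN h).mp h.2⟩ : galFixing K₂ (embField K₂ M)) := by
  obtain ⟨ψ₀, hψ₀, -, hU₀, hL₀⟩ := exists_unitsTransport_level α
  obtain rfl : ψ = ψ₀ := unitsTransport_unique hψ₀ hψ hU₀ hU
  exact hL₀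

end Prop121vii

end Literature.AnabelianGeometry.AbsoluteAnabelian
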